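import Summits.CriticalPhenomena.Ising3D.TaylorQPolyCoeffList
import Literature.MathematicalPhysics.QuantumFieldTheory.ConformalBootstrap3D.PointKernelArith
import Literature.MathematicalPhysics.QuantumFieldTheory.ConformalBootstrap3D.RadialConversion
import Mathlib.Tactic.Linarith
import Mathlib.Tactic.Positivity
import Mathlib.Tactic.Ring
import Mathlib.Tactic.FieldSimp
import HarnessLib

/-!
# Interval twins of the q-polynomial coefficient lists (kernel-computable enclosures, format-free)
(cell `pub-ising3x`, seat recog-1 gen 11; gate (g2): the computable side of `TaylorQPolyCoeffList`)

HONEST FRAMING: lottery ticket; floor = tightest certified 3D Ising CFT bounds; no exact-solution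
claim without a proof.

`TaylorQPolyCoeffList` expresses `C(α,n)`, `q¹/q²(s,α;a)` and the weighted q-sum `E ↦ qSum c S s σ E j` as
real "shadow" coefficient lists (`PolyMP.evalR`). Here are their COMPUTABLE interval twins over the tree's
fixed-point intervals `MI` (scale `S`) with the coefficientwise membership theorems `PMem` the interval
checkers (`shiftI`, `posOn`, the Taylor models `TMem`/`tmulI`/`tlowerI`) consume:
* `descPochListQ`, `chooseCoeffListQ : ℕ → List ℚ` (exact rational constants; `map (↑) = …List`) and
  `chooseCoeffListI S n` (`pmem_chooseCoeffListI`);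
* `signedChooseI S sI i ∋ (-1)^i C(s,i)` for `s ∈ sI` by the exact recurrence `T_{i+1} = T_i (i - s)/(i+1)`
  (`mem_signedChooseI`, by the tree's `ring_choose_succ`) — the ONLY place the box enters (`s = Δσ`, `Δε` or `s̄` enclosed once per box);
* `sumI`, `sumListI`, `scaleI`, `affineI`, `smulQI` with `pmem_*`;
* `qFactor₁ListI`, `qFactor₂ListI` (`pmem_qFactor₁ListI`), `qSumRowI`, `qSumListLI` and
  **`pmem_qSumListLI`**: for rational weights `cQ`, sign `σQ`, index list `l` and `s ∈ sI`,
  `PMem S (qSumListL (↑cQ) l s σQ j) (qSumListLI S cQ σQ (signedChooseI S sI) l j)`.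
With `evalR_qSumListL` this makes every head-cell q-sum of a kind-`deriv` certificate an interval polynomial
in `E` (hence in `Δ` after `shiftI`), with no new mathematics per certificate. Elementary. [folklore]
-/

namespace Summit.CriticalPhenomena.Ising3D

open Finset
open Literature.Analysis.ValidatedNumerics Literature.Analysis.ValidatedNumerics.PolyMP
open Literature.Analysis.ValidatedNumerics.NumericsMP (MI)
open Literature.MathematicalPhysics.QuantumFieldTheory.ConformalBootstrap3D
open PointKernel (legendreLamQ cast_legendreLamQ)

/-! ### Rational twins of the constant lists -/

/-- Coefficientwise sum over `ℚ`. [folklore] -/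
def addQL : List ℚ → List ℚ → List ℚ
  | [], bs => bs
  | a :: as, [] => a :: as
  | a :: as, b :: bs => (a + b) :: addQL as bs

/-- [folklore] -/
theorem map_cast_addQL : ∀ as bs : List ℚ,
    ((addQL as bs).map ((↑) : ℚ → ℝ)) = addR (as.map ((↑) : ℚ → ℝ)) (bs.map ((↑) : ℚ → ℝ))
  | [], bs => by simp [addQL, addR]
  | a :: as, [] => by simp [addQL, addR]
  | a :: as, b :: bs => by
      simp only [addQL, addR, List.map_cons, Rat.cast_add, map_cast_addQL as bs]

/-- Scalar multiple over `ℚ`. [folklore] -/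
def smulQL (c : ℚ) (as : List ℚ) : List ℚ := as.map (c * ·)

/-- [folklore] -/
theorem map_cast_smulQL (c : ℚ) (as : List ℚ) :
    ((smulQL c as).map ((↑) : ℚ → ℝ)) = smulR (c : ℝ) (as.map ((↑) : ℚ → ℝ)) := by
  simp [smulQL, smulR, List.map_map]

/-- Product over `ℚ`. [folklore] -/
def mulQL : List ℚ → List ℚ → List ℚ
  | [], _ => []
  | a :: as, bs => addQL (smulQL a bs) (0 :: mulQL as bs)

/-- [folklore] -/
theorem map_cast_mulQL : ∀ as bs : List ℚ,
    ((mulQL as bs).map ((↑) : ℚ → ℝ)) = mulR (as.map ((↑) : ℚ → ℝ)) (bs.map ((↑) : ℚ → ℝ))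
  | [], bs => by simp [mulQL, mulR]
  | a :: as, bs => by
      rw [mulQL, map_cast_addQL, map_cast_smulQL, List.map_cons, map_cast_mulQL as bs, List.map_cons, mulR,
        Rat.cast_zero]

/-- The falling factorial's coefficient list over `ℚ`. [folklore] -/
def descPochListQ : ℕ → List ℚ
  | 0 => [1]
  | n + 1 => mulQL (descPochListQ n) [-(n : ℚ), 1]

/-- [folklore] -/
theorem map_cast_descPochListQ : ∀ n : ℕ, ((descPochListQ n).map ((↑) : ℚ → ℝ)) = descPochList n
  | 0 => by simp [descPochListQ, descPochList]
  | n + 1 => by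
      rw [descPochListQ, map_cast_mulQL, map_cast_descPochListQ n, descPochList]
      simp

/-- `α ↦ C(α,n)` as an exact rational coefficient list (a table hard-codes these). [folklore] -/
def chooseCoeffListQ (n : ℕ) : List ℚ := smulQL ((n.factorial : ℚ)⁻¹) (descPochListQ n)

/-- [folklore] -/
theorem map_cast_chooseCoeffListQ (n : ℕ) :
    ((chooseCoeffListQ n).map ((↑) : ℚ → ℝ)) = chooseCoeffList n := by
  rw [chooseCoeffListQ, map_cast_smulQL, map_cast_descPochListQ, chooseCoeffList]
  simp

/-- Fixture: `chooseCoeffListQ 3 = [0, 1/3, -1/2, 1/6]`. [folklore] -/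
theorem chooseCoeffListQ_three : chooseCoeffListQ 3 = [0, 1 / 3, -1 / 2, 1 / 6] := by
  norm_num [chooseCoeffListQ, descPochListQ, mulQL, addQL, smulQL, Nat.factorial]

/-! ### Interval lists: constants, sums, substitutions -/

/-- Thin intervals of a rational list. [folklore] -/
def ofRatList (S : ℕ) (l : List ℚ) : IPoly := l.map (PolyMP.ofRat S)

/-- [folklore] -/
theorem pmem_ofRatList (S : ℕ) : ∀ l : List ℚ, PMem S (l.map ((↑) : ℚ → ℝ)) (ofRatList S l)
  | [] => pmem_nil S
  | q :: l => by
      simp only [ofRatList, List.map_cons]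
      exact pmem_cons (mem_ofRat S q) (pmem_ofRatList S l)

/-- `α ↦ C(α,n)` as an interval list (thin). [folklore] -/
def chooseCoeffListI (S n : ℕ) : IPoly := ofRatList S (chooseCoeffListQ n)

/-- [folklore] -/
theorem pmem_chooseCoeffListI (S n : ℕ) : PMem S (chooseCoeffList n) (chooseCoeffListI S n) := by
  rw [← map_cast_chooseCoeffListQ]
  exact pmem_ofRatList S _

/-- Exact rational scaling of an interval list (`I ↦ (I · num) / den`). [folklore] -/
def smulQI (q : ℚ) (P : IPoly) : IPoly := P.map fun I => MI.divNat (MI.mulInt I q.num) q.den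

/-- [folklore] -/
theorem pmem_smulQI {S : ℕ} (q : ℚ) {r : ℝ} (hq : (q : ℝ) = r) :
    ∀ {as : List ℝ} {P : IPoly}, PMem S as P → PMem S (smulR r as) (smulQI q P)
  | _, _, List.Forall₂.nil => by simpa [smulR, smulQI] using pmem_nil S
  | _, _, List.Forall₂.cons (a := a) (b := I) ha hP => by
      simp only [smulR, smulQI, List.map_cons]
      refine List.Forall₂.cons ?_ (pmem_smulQI q hq hP)
      have h := MI.mem_divNat (MI.mem_mulInt ha q.num) q.den_pos
      have e : a * (q.num : ℝ) / (q.den : ℝ) = r * a := by rw [← hq, Rat.cast_def]; ring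
      rw [e] at h
      exact h

/-- `Σ_{i<k}` of interval lists. [folklore] -/
def sumI (F : ℕ → IPoly) : ℕ → IPoly
  | 0 => []
  | k + 1 => addI (sumI F k) (F k)

/-- [folklore] -/
theorem pmem_sumI {S : ℕ} {f : ℕ → List ℝ} {F : ℕ → IPoly} :
    ∀ k : ℕ, (∀ i, i < k → PMem S (f i) (F i)) → PMem S (sumR f k) (sumI F k)
  | 0, _ => pmem_nil S
  | k + 1, h => by
      rw [sumR, sumI]
      exact pmem_addI (pmem_sumI k fun i hi => h i (Nat.lt_succ_of_lt hi)) (h k (Nat.lt_succ_self k))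

/-- Coefficientwise sum of interval lists over an index list. [folklore] -/
def sumListI {ι : Type*} (l : List ι) (F : ι → IPoly) : IPoly := l.foldr (fun i acc => addI (F i) acc) []

/-- [folklore] -/
theorem pmem_sumListI {S : ℕ} {ι : Type*} {f : ι → List ℝ} {F : ι → IPoly} :
    ∀ l : List ι, (∀ i ∈ l, PMem S (f i) (F i)) → PMem S (sumListR l f) (sumListI l F)
  | [], _ => pmem_nil S
  | i :: l, h => by
      simp only [sumListR, sumListI, List.foldr_cons]
      exact pmem_addI (h i (List.mem_cons_self)) (pmem_sumListI l fun i' hi' => h i' (List.mem_cons_of_mem _ hi'))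

/-- Interval twin of `scaleR`. [folklore] -/
def scaleI (S : ℕ) : IPoly → MI → IPoly
  | [], _ => []
  | I :: P, M => I :: smulI S M (scaleI S P M)

/-- [folklore] -/
theorem pmem_scaleI {S : ℕ} (hS : 0 < S) {μ : ℝ} {M : MI} (hμ : MI.mem S μ M) :
    ∀ {as : List ℝ} {P : IPoly}, PMem S as P → PMem S (scaleR as μ) (scaleI S P M)
  | _, _, List.Forall₂.nil => by simpa [scaleR, scaleI] using pmem_nil S
  | _, _, List.Forall₂.cons (a := a) (b := I) ha hP => by
      simp only [scaleR, scaleI]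
      exact pmem_cons ha (pmem_smulI hS hμ (pmem_scaleI hS hμ hP))

/-- Interval twin of `affineR`. [folklore] -/
def affineI (S : ℕ) (P : IPoly) (M N : MI) : IPoly := scaleI S (shiftI S P N) M

/-- [folklore] -/
theorem pmem_affineI {S : ℕ} (hS : 0 < S) {μ ν : ℝ} {M N : MI} (hμ : MI.mem S μ M) (hν : MI.mem S ν N)
    {as : List ℝ} {P : IPoly} (h : PMem S as P) : PMem S (affineR as μ ν) (affineI S P M N) :=
  pmem_scaleI hS hμ (pmem_shiftI hS hν h)

/-! ### The only box-dependent input: `(-1)^i C(s,i)` for `s` in an interval -/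

/-- `(-1)^i C(s,i)` by the exact recurrence `T₀ = 1`, `T_{i+1} = T_i · (i - s)/(i+1)` on intervals.
[folklore] -/
def signedChooseI (S : ℕ) (sI : MI) : ℕ → MI
  | 0 => MI.ofInt S 1
  | i + 1 => MI.divNat (MI.mul S (signedChooseI S sI i) (MI.sub (MI.ofInt S i) sI)) (i + 1)

/-- **`(-1)^i C(s,i) ∈ signedChooseI S sI i`** for `s ∈ sI`. [folklore] -/
theorem mem_signedChooseI {S : ℕ} (hS : 0 < S) {s : ℝ} {sI : MI} (hs : MI.mem S s sI) :
    ∀ i : ℕ, MI.mem S ((-1) ^ i * Ring.choose s i) (signedChooseI S sI i)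
  | 0 => by
      rw [signedChooseI, pow_zero, one_mul, Ring.choose_zero_right]
      simpa using MI.mem_ofInt S 1
  | i + 1 => by
      have ih := mem_signedChooseI hS hs i
      have hsub : MI.mem S ((i : ℝ) - s) (MI.sub (MI.ofInt S i) sI) := by
        have := MI.mem_sub (MI.mem_ofInt S (i : ℤ)) hs
        simpa using this
      have h := MI.mem_divNat (MI.mem_mul hS ih hsub) (Nat.succ_pos i)
      have heq : (-1 : ℝ) ^ (i + 1) * Ring.choose s (i + 1) =
          (-1) ^ i * Ring.choose s i * ((i : ℝ) - s) / ((i + 1 : ℕ) : ℝ) := by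
        rw [ring_choose_succ, pow_succ]
        push_cast
        ring
      rw [heq]
      exact h

/-! ### The q-factors and q-sums as interval lists -/

/-- Interval twin of `qFactor₁List s a`, from enclosures `C i ∋ (-1)^i C(s,i)`, `i ≤ a`. [folklore] -/
def qFactor₁ListI (S : ℕ) (C : ℕ → MI) (a : ℕ) : IPoly :=
  sumI (fun i => smulI S (C i) (chooseCoeffListI S (a - i))) (a + 1)

/-- [folklore] -/
theorem pmem_qFactor₁ListI {S : ℕ} (hS : 0 < S) {s : ℝ} {C : ℕ → MI} {a : ℕ}
    (hC : ∀ i, i ≤ a → MI.mem S ((-1) ^ i * Ring.choose s i) (C i)) :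
    PMem S (qFactor₁List s a) (qFactor₁ListI S C a) :=
  pmem_sumI (a + 1) fun i hi => pmem_smulI hS (hC i (Nat.lt_succ_iff.mp hi)) (pmem_chooseCoeffListI S _)

/-- Interval twin of `qFactor₂List s a = (-1)^a · qFactor₁List s a`. [folklore] -/
def qFactor₂ListI (S : ℕ) (C : ℕ → MI) (a : ℕ) : IPoly := smulIntI ((-1) ^ a) (qFactor₁ListI S C a)

/-- [folklore] -/
theorem pmem_qFactor₂ListI {S : ℕ} (hS : 0 < S) {s : ℝ} {C : ℕ → MI} {a : ℕ}
    (hC : ∀ i, i ≤ a → MI.mem S ((-1) ^ i * Ring.choose s i) (C i)) :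
    PMem S (qFactor₂List s a) (qFactor₂ListI S C a) := by
  have h := pmem_smulIntI ((-1 : ℤ) ^ a) (pmem_qFactor₁ListI hS hC)
  rw [qFactor₂List, qFactor₂ListI]
  convert h using 2
  push_cast
  ring

/-- Interval twin of `qSumRow (↑cQ) s σQ j ab` (rational weights and sign; `C i ∋ (-1)^i C(s,i)`). [folklore] -/
def qSumRowI (S : ℕ) (cQ : ℕ × ℕ → ℚ) (σQ : ℚ) (C : ℕ → MI) (j : ℕ) (ab : ℕ × ℕ) : IPoly :=
  smulQI (cQ ab * 2 ^ (ab.1 + ab.2))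
    (sumI (fun p => smulQI (legendreLamQ p * legendreLamQ (j - p))
      (addI
        (mulI S (affineI S (qFactor₁ListI S C ab.1) (PolyMP.ofRat S (1 / 2)) (PolyMP.ofRat S ((p : ℚ) - (j : ℚ) / 2)))
          (affineI S (qFactor₁ListI S C ab.2) (PolyMP.ofRat S (1 / 2))
            (PolyMP.ofRat S (((j - p : ℕ) : ℚ) - (j : ℚ) / 2))))
        (smulQI σQ (mulI S
          (affineI S (qFactor₂ListI S C ab.1) (PolyMP.ofRat S (1 / 2)) (PolyMP.ofRat S ((p : ℚ) - (j : ℚ) / 2)))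
          (affineI S (qFactor₂ListI S C ab.2) (PolyMP.ofRat S (1 / 2))
            (PolyMP.ofRat S (((j - p : ℕ) : ℚ) - (j : ℚ) / 2))))))) (j + 1))

/-- [folklore] -/
theorem pmem_qSumRowI {S : ℕ} (hS : 0 < S) {s : ℝ} {C : ℕ → MI} (cQ : ℕ × ℕ → ℚ) (σQ : ℚ) (j : ℕ)
    (ab : ℕ × ℕ) (hC : ∀ i, i ≤ max ab.1 ab.2 → MI.mem S ((-1) ^ i * Ring.choose s i) (C i)) :
    PMem S (qSumRow (fun ab => (cQ ab : ℝ)) s (σQ : ℝ) j ab) (qSumRowI S cQ σQ C j ab) := by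
  have hC1 : ∀ i, i ≤ ab.1 → MI.mem S ((-1) ^ i * Ring.choose s i) (C i) :=
    fun i hi => hC i (hi.trans (le_max_left _ _))
  have hC2 : ∀ i, i ≤ ab.2 → MI.mem S ((-1) ^ i * Ring.choose s i) (C i) :=
    fun i hi => hC i (hi.trans (le_max_right _ _))
  have hhalf : MI.mem S (1 / 2 : ℝ) (PolyMP.ofRat S (1 / 2)) := by
    have h := mem_ofRat S (1 / 2 : ℚ); push_cast at h; exact h
  have hsh : ∀ p : ℕ, MI.mem S ((p : ℝ) - (j : ℝ) / 2) (PolyMP.ofRat S ((p : ℚ) - (j : ℚ) / 2)) := by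
    intro p; have h := mem_ofRat S ((p : ℚ) - (j : ℚ) / 2); push_cast at h; exact h
  have hsh' : ∀ p : ℕ, MI.mem S (((j - p : ℕ) : ℝ) - (j : ℝ) / 2)
      (PolyMP.ofRat S (((j - p : ℕ) : ℚ) - (j : ℚ) / 2)) := by
    intro p; have h := mem_ofRat S (((j - p : ℕ) : ℚ) - (j : ℚ) / 2); push_cast at h; exact h
  unfold qSumRow qSumRowI
  refine pmem_smulQI _ (by push_cast; ring) (pmem_sumI (j + 1) fun p _ => ?_)
  refine pmem_smulQI _ (by rw [Rat.cast_mul, cast_legendreLamQ, cast_legendreLamQ]) (pmem_addI ?_ ?_)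
  · exact pmem_mulI hS (pmem_affineI hS hhalf (hsh p) (pmem_qFactor₁ListI hS hC1))
      (pmem_affineI hS hhalf (hsh' p) (pmem_qFactor₁ListI hS hC2))
  · exact pmem_smulQI _ rfl (pmem_mulI hS (pmem_affineI hS hhalf (hsh p) (pmem_qFactor₂ListI hS hC1))
      (pmem_affineI hS hhalf (hsh' p) (pmem_qFactor₂ListI hS hC2)))

/-- Interval twin of `qSumListL (↑cQ) l s σQ j`. [folklore] -/
def qSumListLI (S : ℕ) (cQ : ℕ × ℕ → ℚ) (σQ : ℚ) (C : ℕ → MI) (l : List (ℕ × ℕ)) (j : ℕ) : IPoly :=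
  sumListI l (qSumRowI S cQ σQ C j)

/-- [folklore] -/
theorem pmem_qSumListLI {S : ℕ} (hS : 0 < S) {s : ℝ} {C : ℕ → MI} (cQ : ℕ × ℕ → ℚ) (σQ : ℚ)
    (l : List (ℕ × ℕ)) (j : ℕ) (hC : ∀ ab ∈ l, ∀ i, i ≤ max ab.1 ab.2 → MI.mem S ((-1) ^ i * Ring.choose s i) (C i)) :
    PMem S (qSumListL (fun ab => (cQ ab : ℝ)) l s (σQ : ℝ) j) (qSumListLI S cQ σQ C l j) :=
  pmem_sumListI l fun ab hab => pmem_qSumRowI hS cQ σQ j ab (hC ab hab)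

/-- **Table-facing package.** For rational weights `cQ`, sign `σQ`, a duplicate-free index list `l`, and
`s ∈ sI`: the q-sum `E ↦ qSum (↑cQ) l.toFinset s σQ E j` is `evalR` of a real list that lies coefficientwise in
the computable interval list `qSumListLI S cQ σQ (signedChooseI S sI) l j`. [folklore] -/
theorem qSum_mem_intervalList {S : ℕ} (hS : 0 < S) {s : ℝ} {sI : MI} (hs : MI.mem S s sI)
    (cQ : ℕ × ℕ → ℚ) (σQ : ℚ) {l : List (ℕ × ℕ)} (hl : l.Nodup) (j : ℕ) :
    (∀ E : ℝ, qSum (fun ab => (cQ ab : ℝ)) l.toFinset s (σQ : ℝ) E j =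
        evalR (qSumListL (fun ab => (cQ ab : ℝ)) l s (σQ : ℝ) j) E) ∧
      PMem S (qSumListL (fun ab => (cQ ab : ℝ)) l s (σQ : ℝ) j)
        (qSumListLI S cQ σQ (signedChooseI S sI) l j) :=
  ⟨fun E => (evalR_qSumListL _ hl s _ j E).symm,
    pmem_qSumListLI hS cQ σQ l j fun _ _ i _ => mem_signedChooseI hS hs i⟩

end Summit.CriticalPhenomena.Ising3D
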